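/-
Copyright (c) 2026 the pub-hodgecm-mathlib formalisation cell (harness21).  Prover seat hodgecm-mathlib-LH7-p08 (g0) (re-dealt to strike line L3 `stub_N6nsDyadic` by director
s1969 (a)), Track A «(D-RAM) FOUR-FRAME» squad, helper lane on h413 = stmt-HodgeConjecture-24833 (count-neutral).  β-BOARD v1 row R8 ∕ (P5) «H `(2ρ,2ρ,2ρ)`», FILE 2a: the
two-slot label read on the core-hanging normal form and on the orbit representative `V_H(1,1,g)` — the `t′ = 0` twin of LH4-p13 (g8)'s ★ (L-lab-20c).  2026-09-04.
-/
import Summits.HodgeConjecture.HodgeConjecture.Theorems.F0P3cDyRamTwoSlotLabelReadGlued            -- ★ (L-lab-20c) (LH4-p13 (g8)): `valueClassLabel_latt_hnf_iff_normSign_linear_of_one_le`; brings ★ (L-lab-20a), ★ `normSign_mul_norm`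
import Summits.HodgeConjecture.HodgeConjecture.Theorems.F0P3cDyRamDiagonalCoreHangingCount           -- ★ B7 (iv) (C) (LH4-p07 (g3)): `isNormalisedLattice_latt_coreHanging`
import HarnessLib

/-!
# Crux `H413`, line LH4 «(D-RAM) FOUR-FRAME» — (β) table, β-BOARD row R8 ∕ (P5), FILE 2a: «THE TWO-SLOT LABEL READ ON THE CORE-HANGING STRATA AND ON `V_H(1,1,g)`» —
# the `t′ = 0` twin of ★ (L-lab-20c) `F0P3cDyRamTwoSlotLabelReadGlued`

Cell `hodgecm-mathlib` (D-0151), FLOOR 0, crux item H413 = `stmt-HodgeConjecture-24833`, route `HCCMUnconditional`; squad F0∕P3c∕LH4.  THEOREMS ONLY (no `def`, no instance, no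
notation, no `sorry`, default heartbeats); ★-only imports; lane `--supports stmt-HodgeConjecture-24833 --as helper` (count-neutral); pays NO row, states NO law.

WHY (this seat's H-ROW DERIVATION v1 e4da7f0103cc4a29 §2).  The core-hanging stratum `H(ρ)` is the glued family AT `t′ = 0`: its members are `latt(1 0 0; x ϖ^ρ 0; xζ+y″ ϖ^ρζ ϖ^{2ρ})`
(★ B7 `stratum_H_eq`), its 𝒯-orbit representatives `V_H(1,1,g) = latt(1 0 0; 1 ϖ^ρ 0; 1+g ϖ^ρ ϖ^{2ρ})` with `g` a σ-FIXED UNIT, `|1 + g| = 1` (★ B7 (iv) (C), ★ (A)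
`exists_coreHanging_of_mem_orbit`), polarised by `D(g) = π₀^{−ρ}·(g, 1, −(1+g)⁻¹)` (★ κH (A1)).  ★ (L-lab-20c)'s reads are stated for the glued representative with `|g| < 1`
(`t′ ≥ 1`); here `|g| = 1`, and the only uses of `|g| < 1` there — `|1 + g| ≤ 1` and `1 + g ≠ 0` — are replaced by the H hypothesis `|1 + g| = 1`.  So, verbatim otherwise:
* §1 `valueClassLabel_latt_coreHanging_iff_normSign_linear` — on the normal form (any units `x, ζ`, any `y″` with `|xζ + y″| = 1`, `ρ ≥ 1`), any type-0 σ-fixed polarisation `D`, `T`-stable,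
  clean shell (the three tokens as hypotheses — on `H(ρ)` they read `2ρ + ℓ₀ = min(n₁,n₂)`, FILE 1 ★-pending `F0P3cDyRamLabelledOddCoreHangingShell.shell_iff_of_mem_stratum_H`), fixed
  approximants `g_α, g_β` to precision `ϖ^{m*}` after the weights `D₀`, `D₁N(x)`: `valueClassLabel … (latt V) D ↔ normSign σ (D₀·g_α + D₁·N(x)·g_β) = 1` (★ (L-lab-20c) §1 at `b = ρ ≥ 1`).
* §2 `valueClassLabel_coreHanging_rep_iff_normSign` (x = ζ = 1, y″ = g) and **`valueClassLabel_coreHanging_rep_class_iff_normSign`**: for the class `D = D(g)·u` (`u` σ-fixed units)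
  the label is `ω(u₀·g·g_α + u₁·g_β)` — the `lam` of ★ (L-lab-20b∕20d) `two_mul_card_mul_labelledOddCount_eq_sum_of_classSign` on the H orbit: with the ★ product transversal
  `R₀ = {a₀(1,ψ,ψy)}` AT `t = 0` this is `λ(r) = ω(a₀)·ω(g·g_α + ψ·g_β)` (DERIVATION §2), the input of FILE 2b.
HONEST LABEL.  Count-neutral (`--supports`); the per-orbit class sum (FILE 2b), the character sums (FILE 2c), the R8 value, `hRest`, (T3), (β-BAL), (β), T₊ stay OPEN; `HC_CM` is
proved only modulo the 7 printed citations (2 remaining named inputs: hLiu418 = `stmt-HodgeConjecture-24832`, h413 = `stmt-HodgeConjecture-24833`) until rung 0 closes.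

## References
* [Rogawski1990] J. D. Rogawski, *Automorphic Representations of Unitary Groups in Three Variables*, Ann. of Math. Stud. 123 (1990), §4.9 Prop. 4.9.1 (b) p. 55.
* [Serre1979] J.-P. Serre, *Local Fields*, GTM 67 (1979), Ch. V §3 Cor. 3 (norm classes of units of a ramified quadratic extension).
* [Kottwitz1986BaseChangeUnits] R. E. Kottwitz, *Base change for unit elements of Hecke algebras*, Compositio Math. 60 (1986), §1 pp. 240–241.
-/

set_option autoImplicit false

noncomputable section

namespace Summit.HodgeConjecture.HodgeConjecture.Cruxes.H413.F0P3cDyRamTwoSlotLabelReadCoreHanging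

open Literature.NumberTheory.Automorphic Literature.NumberTheory.Automorphic.HermitianLattice Literature.NumberTheory.Automorphic.UnitaryGroup
open Literature.NumberTheory.Automorphic.UnitaryLatticeTree Literature.NumberTheory.Automorphic.UnitaryThreeFourFrame
open Literature.NumberTheory.LocalFields Literature.NumberTheory.LocalFields.WildQuadraticDatum
open Summit.HodgeConjecture.HodgeConjecture.Cruxes.H413.F0P3cDyRamFourFramePieces
open Summit.HodgeConjecture.HodgeConjecture.Cruxes.H413.F0P3cDyRamFourFrameCensusDefs
open Summit.HodgeConjecture.HodgeConjecture.Cruxes.H413.F0P3cDyRamDiagonalTorusDefs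
open Summit.HodgeConjecture.HodgeConjecture.Cruxes.H413.F0P3cDyRamLabelledOddCountDefs (valueClassLabel)
open Summit.HodgeConjecture.HodgeConjecture.Cruxes.H413.F0P3cDyRamTwoSlotLabelReadGlued (valueClassLabel_latt_hnf_iff_normSign_linear_of_one_le)
open Summit.HodgeConjecture.HodgeConjecture.Cruxes.H413.F0P3cDyRamDiagonalCoreHangingCount (isNormalisedLattice_latt_coreHanging)
open Summit.HodgeConjecture.HodgeConjecture.Cruxes.H413.F0P3cDyRamFixedCountDiagonalModel (normSign_mul_norm)
open scoped Valued WithZero Matrix MatrixGroups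
open WithZero

variable {K : Type} [Field K] [Valued K ℤᵐ⁰]

/-! ## §1  The normal form `latt(1 0 0; x ϖ^ρ 0; xζ+y″ ϖ^ρζ ϖ^{2ρ})` -/

/-- **THE TWO-SLOT LABEL READ ON THE CORE-HANGING NORMAL FORM** (`|x| = |ζ| = 1`, `|xζ + y″| = 1`, `ρ ≥ 1`), any type-0 σ-fixed polarisation `D`, `T`-stable, clean shell, fixed
approximants `g_α`, `g_β` (`|ϖ^{−m*}·D₀((α−1) − g_α t₊)| ≤ 1`, `|ϖ^{−m*}·D₁N(x)((β−1) − g_β t₊)| ≤ 1`):  `valueClassLabel σ ϖ (α−1) (β−1) m* d (latt V) D ↔ normSign σ (D₀·g_α + D₁·N(x)·g_β) = 1`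
— ★ (L-lab-20c) `…_of_one_le` at `b = ρ`, `c = 2ρ`, `y = xζ + y″`, `z = ϖ^ρζ` (normalised by ★ B7 (iv) (C)). [cite: Rogawski1990, §4.9 Prop. 4.9.1 (b) p. 55] [cite: Serre1979, Ch. V §3 Cor. 3]
[cite: Kottwitz1986BaseChangeUnits, §1 pp. 240–241] -/
theorem valueClassLabel_latt_coreHanging_iff_normSign_linear [CompleteSpace K] {σ : K →+* K} {ϖ : K} {d t : ℕ} (hDat : IsRamifiedQuadraticDatum σ ϖ d t)
    {ρ : ℕ} (hρ : 1 ≤ ρ) {x ζ y'' : K} (hx : Valued.v x = 1) (hζ : Valued.v ζ = 1) (hy : Valued.v (x * ζ + y'') = 1)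
    (V : GL (Fin 3) K) (hV : (V : Matrix (Fin 3) (Fin 3) K) = !![1, 0, 0; x, ϖ ^ ρ, 0; x * ζ + y'', ϖ ^ ρ * ζ, ϖ ^ (2 * ρ)])
    {D : Fin 3 → K} (hDσ : ∀ i, σ (D i) = D i) (hD0 : ∀ i, D i ≠ 0) (hM : IsVertexLattice σ ϖ (Matrix.diagonal D) 0 (latt (V : Matrix (Fin 3) (Fin 3) K)))
    {α β : K} {N₀ n₁ n₂ n₃ : ℕ} (hE : IsElementDatum σ ϖ N₀ α β n₁ n₂ n₃) {mc : ℕ} (hℓN : d % 2 + 1 ≤ N₀) (hmN : d % 2 + 2 * d - 1 ≤ N₀)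
    (hℓmc : 2 * (d % 2) + 1 ≤ mc) (hmmc : d % 2 + 2 * d - 1 + d % 2 ≤ mc)
    (hlev : LatticeInLevel ϖ (d % 2) (Matrix.diagonal ![α - 1, β - 1, 0]) (latt (V : Matrix (Fin 3) (Fin 3) K)))
    (hnlev : ¬ LatticeInLevel ϖ (d % 2 + 1) (Matrix.diagonal ![α - 1, β - 1, 0]) (latt (V : Matrix (Fin 3) (Fin 3) K)))
    (hsq : LatticeInLevel ϖ mc (Matrix.diagonal ![(α - 1) * (α - 1), (β - 1) * (β - 1), 0]) (latt (V : Matrix (Fin 3) (Fin 3) K)))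
    {T : GL (Fin 3) K} (hT : (T : Matrix (Fin 3) (Fin 3) K) = Matrix.diagonal ![α, β, 1]) (hTM : mapGL T (latt (V : Matrix (Fin 3) (Fin 3) K)) = latt (V : Matrix (Fin 3) (Fin 3) K))
    {gα gβ : K} (hσgα : σ gα = gα) (hσgβ : σ gβ = gβ)
    (hgα : Valued.v ((ϖ ^ (d % 2 + 2 * d - 1))⁻¹ * (D 0 * ((α - 1) - gα * ((ϖ - σ ϖ) * ((ϖ * σ ϖ) ^ ((d - d % 2) / 2))⁻¹)))) ≤ 1)
    (hgβ : Valued.v ((ϖ ^ (d % 2 + 2 * d - 1))⁻¹ * (D 1 * (x * σ x) * ((β - 1) - gβ * ((ϖ - σ ϖ) * ((ϖ * σ ϖ) ^ ((d - d % 2) / 2))⁻¹)))) ≤ 1) :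
    valueClassLabel σ ϖ (α - 1) (β - 1) (d % 2 + 2 * d - 1) d (latt (V : Matrix (Fin 3) (Fin 3) K)) D ↔ normSign σ (D 0 * gα + D 1 * (x * σ x) * gβ) = 1 := by
  obtain ⟨-, -, hϖ, -, -, -, -⟩ := id hDat
  have hϖ1 : Valued.v ϖ ≤ 1 := by rw [hϖ, ← exp_zero, exp_le_exp]; norm_num
  have hz : Valued.v (ϖ ^ ρ * ζ) ≤ 1 := by rw [map_mul, hζ, mul_one, map_pow]; exact pow_le_one₀ zero_le hϖ1
  have hn := isNormalisedLattice_latt_coreHanging hϖ1 ρ hx hζ hy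
  rw [hV] at hM hlev hnlev hsq hTM ⊢
  exact valueClassLabel_latt_hnf_iff_normSign_linear_of_one_le hDat hDσ hD0 hx.le hy.le hz hn hM hE hℓN hmN hℓmc hmmc hlev hnlev hsq hT hTM hρ hσgα hσgβ hgα hgβ

/-! ## §2  The orbit representative `V_H(1,1,g)` and its classes `D(g)·u` -/

/-- **THE TWO-SLOT LABEL READ ON `latt V_H(1,1,g)`** (`V_H = [[1,0,0],[1,ϖ^ρ,0],[1+g,ϖ^ρ,ϖ^{2ρ}]]`, `ρ ≥ 1`, `|1 + g| = 1`), any type-0 σ-fixed polarisation `D`, `T`-stable, clean shell: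
`valueClassLabel … (latt V_H) D ↔ normSign σ (D₀·g_α + D₁·g_β) = 1` (§1 at `x = ζ = 1`, `y″ = g`: `N(x) = 1`). [cite: Rogawski1990, §4.9 Prop. 4.9.1 (b) p. 55] [cite: Serre1979, Ch. V §3 Cor. 3]
[cite: Kottwitz1986BaseChangeUnits, §1 pp. 240–241] -/
theorem valueClassLabel_coreHanging_rep_iff_normSign [CompleteSpace K] {σ : K →+* K} {ϖ : K} {d t : ℕ} (hDat : IsRamifiedQuadraticDatum σ ϖ d t)
    {ρ : ℕ} (hρ : 1 ≤ ρ) {g : K} (h1g : Valued.v (1 + g) = 1)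
    (V : GL (Fin 3) K) (hV : (V : Matrix (Fin 3) (Fin 3) K) = !![1, 0, 0; 1, ϖ ^ ρ, 0; 1 * 1 + g, ϖ ^ ρ * 1, ϖ ^ (2 * ρ)])
    {D : Fin 3 → K} (hDσ : ∀ i, σ (D i) = D i) (hD0 : ∀ i, D i ≠ 0) (hM : IsVertexLattice σ ϖ (Matrix.diagonal D) 0 (latt (V : Matrix (Fin 3) (Fin 3) K)))
    {α β : K} {N₀ n₁ n₂ n₃ : ℕ} (hE : IsElementDatum σ ϖ N₀ α β n₁ n₂ n₃) {mc : ℕ} (hℓN : d % 2 + 1 ≤ N₀) (hmN : d % 2 + 2 * d - 1 ≤ N₀)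
    (hℓmc : 2 * (d % 2) + 1 ≤ mc) (hmmc : d % 2 + 2 * d - 1 + d % 2 ≤ mc)
    (hlev : LatticeInLevel ϖ (d % 2) (Matrix.diagonal ![α - 1, β - 1, 0]) (latt (V : Matrix (Fin 3) (Fin 3) K)))
    (hnlev : ¬ LatticeInLevel ϖ (d % 2 + 1) (Matrix.diagonal ![α - 1, β - 1, 0]) (latt (V : Matrix (Fin 3) (Fin 3) K)))
    (hsq : LatticeInLevel ϖ mc (Matrix.diagonal ![(α - 1) * (α - 1), (β - 1) * (β - 1), 0]) (latt (V : Matrix (Fin 3) (Fin 3) K)))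
    {T : GL (Fin 3) K} (hT : (T : Matrix (Fin 3) (Fin 3) K) = Matrix.diagonal ![α, β, 1]) (hTM : mapGL T (latt (V : Matrix (Fin 3) (Fin 3) K)) = latt (V : Matrix (Fin 3) (Fin 3) K))
    {gα gβ : K} (hσgα : σ gα = gα) (hσgβ : σ gβ = gβ)
    (hgα : Valued.v ((ϖ ^ (d % 2 + 2 * d - 1))⁻¹ * (D 0 * ((α - 1) - gα * ((ϖ - σ ϖ) * ((ϖ * σ ϖ) ^ ((d - d % 2) / 2))⁻¹)))) ≤ 1)
    (hgβ : Valued.v ((ϖ ^ (d % 2 + 2 * d - 1))⁻¹ * (D 1 * ((β - 1) - gβ * ((ϖ - σ ϖ) * ((ϖ * σ ϖ) ^ ((d - d % 2) / 2))⁻¹)))) ≤ 1) :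
    valueClassLabel σ ϖ (α - 1) (β - 1) (d % 2 + 2 * d - 1) d (latt (V : Matrix (Fin 3) (Fin 3) K)) D ↔ normSign σ (D 0 * gα + D 1 * gβ) = 1 := by
  have h1g' : Valued.v (1 * 1 + g) = 1 := by rw [one_mul]; exact h1g
  have h := valueClassLabel_latt_coreHanging_iff_normSign_linear hDat hρ (x := 1) (ζ := 1) (y'' := g) (map_one _) (map_one _) h1g' V hV hDσ hD0 hM hE hℓN hmN
    hℓmc hmmc hlev hnlev hsq hT hTM hσgα hσgβ hgα (by rw [map_one, mul_one, mul_one]; exact hgβ)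
  simpa only [map_one, mul_one] using h

/-- **THE LABEL OF THE CLASS `D(g)·u` ON `latt V_H(1,1,g)` IS `ω(u₀·g·g_α + u₁·g_β)`** — `D(g) = π₀^{−ρ}·(g, 1, −(1+g)⁻¹)` the ★ κH (A1) polarisation (the ★ κG-A1 `D(g)` at
`t′ = 0`), `g` a σ-fixed UNIT with `|1 + g| = 1`, `u` σ-fixed units with `diag(D(g)·u)` a type-0 polarisation (every class of `S_F(V_H)`); the common norm `π₀^{−ρ} = N(ϖ^{−ρ})` leaves `ω`.
This is the `lam` of ★ (L-lab-20b∕20d)'s class sum on the H orbit: `2·[N′:N₀]·m^L_i(V_H) = ω(D(g)_i)·Σ_{r ∈ R₀} ω(r_i)·(1 + ω(r₀·g·g_α + r₁·g_β))`.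
[cite: Rogawski1990, §4.9 Prop. 4.9.1 (b) p. 55] [cite: Serre1979, Ch. V §3 Cor. 3] [cite: Kottwitz1986BaseChangeUnits, §1 pp. 240–241] -/
theorem valueClassLabel_coreHanging_rep_class_iff_normSign [CompleteSpace K] {σ : K →+* K} {ϖ : K} {d t : ℕ} (hDat : IsRamifiedQuadraticDatum σ ϖ d t)
    {ρ : ℕ} (hρ : 1 ≤ ρ) {g : K} (hg0 : g ≠ 0) (h1g : Valued.v (1 + g) = 1) (hσg : σ g = g)
    (V : GL (Fin 3) K) (hV : (V : Matrix (Fin 3) (Fin 3) K) = !![1, 0, 0; 1, ϖ ^ ρ, 0; 1 * 1 + g, ϖ ^ ρ * 1, ϖ ^ (2 * ρ)])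
    {u : Fin 3 → K} (hσu : ∀ i, σ (u i) = u i) (hu0 : ∀ i, u i ≠ 0)
    (hM : IsVertexLattice σ ϖ (Matrix.diagonal fun j => (![((ϖ * σ ϖ) ^ ρ)⁻¹ * g, ((ϖ * σ ϖ) ^ ρ)⁻¹, -(((ϖ * σ ϖ) ^ ρ)⁻¹ * (1 + g)⁻¹)] : Fin 3 → K) j * u j) 0
      (latt (V : Matrix (Fin 3) (Fin 3) K)))
    {α β : K} {N₀ n₁ n₂ n₃ : ℕ} (hE : IsElementDatum σ ϖ N₀ α β n₁ n₂ n₃) {mc : ℕ} (hℓN : d % 2 + 1 ≤ N₀) (hmN : d % 2 + 2 * d - 1 ≤ N₀)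
    (hℓmc : 2 * (d % 2) + 1 ≤ mc) (hmmc : d % 2 + 2 * d - 1 + d % 2 ≤ mc)
    (hlev : LatticeInLevel ϖ (d % 2) (Matrix.diagonal ![α - 1, β - 1, 0]) (latt (V : Matrix (Fin 3) (Fin 3) K)))
    (hnlev : ¬ LatticeInLevel ϖ (d % 2 + 1) (Matrix.diagonal ![α - 1, β - 1, 0]) (latt (V : Matrix (Fin 3) (Fin 3) K)))
    (hsq : LatticeInLevel ϖ mc (Matrix.diagonal ![(α - 1) * (α - 1), (β - 1) * (β - 1), 0]) (latt (V : Matrix (Fin 3) (Fin 3) K)))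
    {T : GL (Fin 3) K} (hT : (T : Matrix (Fin 3) (Fin 3) K) = Matrix.diagonal ![α, β, 1]) (hTM : mapGL T (latt (V : Matrix (Fin 3) (Fin 3) K)) = latt (V : Matrix (Fin 3) (Fin 3) K))
    {gα gβ : K} (hσgα : σ gα = gα) (hσgβ : σ gβ = gβ)
    (hgα : Valued.v ((ϖ ^ (d % 2 + 2 * d - 1))⁻¹ * (((ϖ * σ ϖ) ^ ρ)⁻¹ * g * u 0 * ((α - 1) - gα * ((ϖ - σ ϖ) * ((ϖ * σ ϖ) ^ ((d - d % 2) / 2))⁻¹)))) ≤ 1)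
    (hgβ : Valued.v ((ϖ ^ (d % 2 + 2 * d - 1))⁻¹ * (((ϖ * σ ϖ) ^ ρ)⁻¹ * u 1 * ((β - 1) - gβ * ((ϖ - σ ϖ) * ((ϖ * σ ϖ) ^ ((d - d % 2) / 2))⁻¹)))) ≤ 1) :
    valueClassLabel σ ϖ (α - 1) (β - 1) (d % 2 + 2 * d - 1) d (latt (V : Matrix (Fin 3) (Fin 3) K))
        (fun j => (![((ϖ * σ ϖ) ^ ρ)⁻¹ * g, ((ϖ * σ ϖ) ^ ρ)⁻¹, -(((ϖ * σ ϖ) ^ ρ)⁻¹ * (1 + g)⁻¹)] : Fin 3 → K) j * u j) ↔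
      normSign σ (u 0 * g * gα + u 1 * gβ) = 1 := by
  obtain ⟨hσ, hvσ, hϖ, -, -, -, -⟩ := id hDat
  have hϖ0 : ϖ ≠ 0 := (Valuation.ne_zero_iff Valued.v).1 (by rw [hϖ]; exact exp_ne_zero)
  have hσϖ0 : σ ϖ ≠ 0 := (map_ne_zero σ).2 hϖ0
  have hπ0 : ((ϖ * σ ϖ) ^ ρ : K) ≠ 0 := pow_ne_zero _ (mul_ne_zero hϖ0 hσϖ0)
  have hσπ : σ ((ϖ * σ ϖ) ^ ρ) = (ϖ * σ ϖ) ^ ρ := by rw [map_pow, map_mul, hσ, mul_comm]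
  have h1g0 : 1 + g ≠ 0 := fun h => by rw [h, map_zero] at h1g; exact zero_ne_one h1g
  set D : Fin 3 → K := fun j => (![((ϖ * σ ϖ) ^ ρ)⁻¹ * g, ((ϖ * σ ϖ) ^ ρ)⁻¹, -(((ϖ * σ ϖ) ^ ρ)⁻¹ * (1 + g)⁻¹)] : Fin 3 → K) j * u j with hDdef
  have hD0v : D 0 = ((ϖ * σ ϖ) ^ ρ)⁻¹ * g * u 0 := rfl
  have hD1v : D 1 = ((ϖ * σ ϖ) ^ ρ)⁻¹ * u 1 := rfl
  have hD2v : D 2 = -(((ϖ * σ ϖ) ^ ρ)⁻¹ * (1 + g)⁻¹) * u 2 := rfl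
  have hDσ : ∀ i, σ (D i) = D i := fun i => by
    fin_cases i
    · show σ (D 0) = D 0; rw [hD0v, map_mul, map_mul, map_inv₀, hσπ, hσg, hσu]
    · show σ (D 1) = D 1; rw [hD1v, map_mul, map_inv₀, hσπ, hσu]
    · show σ (D 2) = D 2; rw [hD2v, map_mul, map_neg, map_mul, map_inv₀, map_inv₀, hσπ, map_add, map_one, hσg, hσu]
  have hD0 : ∀ i, D i ≠ 0 := fun i => by
    fin_cases i
    · show D 0 ≠ 0; rw [hD0v]; exact mul_ne_zero (mul_ne_zero (inv_ne_zero hπ0) hg0) (hu0 0)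
    · show D 1 ≠ 0; rw [hD1v]; exact mul_ne_zero (inv_ne_zero hπ0) (hu0 1)
    · show D 2 ≠ 0; rw [hD2v]; exact mul_ne_zero (neg_ne_zero.2 (mul_ne_zero (inv_ne_zero hπ0) (inv_ne_zero h1g0))) (hu0 2)
  have h := valueClassLabel_coreHanging_rep_iff_normSign hDat hρ h1g V hV hDσ hD0 hM hE hℓN hmN hℓmc hmmc hlev hnlev hsq hT hTM hσgα hσgβ
    (by rw [hD0v]; exact hgα) (by rw [hD1v]; exact hgβ)
  rw [h, hD0v, hD1v]
  -- pull the norm `π₀^{−ρ} = N(ϖ^{−ρ})` out of `ω`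
  have hfac : ((ϖ * σ ϖ) ^ ρ)⁻¹ * g * u 0 * gα + ((ϖ * σ ϖ) ^ ρ)⁻¹ * u 1 * gβ = (u 0 * g * gα + u 1 * gβ) * ((ϖ ^ ρ)⁻¹ * σ ((ϖ ^ ρ)⁻¹)) := by
    rw [map_inv₀, map_pow, ← mul_inv, ← mul_pow]; ring
  rw [hfac, normSign_mul_norm σ _ (inv_ne_zero (pow_ne_zero _ hϖ0))]

end Summit.HodgeConjecture.HodgeConjecture.Cruxes.H413.F0P3cDyRamTwoSlotLabelReadCoreHanging

end
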